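import Summits.CriticalPhenomena.PercolationContinuityZ3.Theorems.PercNearOneGluingNoHeavyLowerTailCILAveragedPortForward
import HarnessLib

/-!
# `NoHeavyLowerTail` (stmt-CriticalPhenomena-4575) — AP1⁺: averaged port domination WITH THE ISOLATION SLACK (forward-greedy order)

Support file (prover `prim-hp-6`, hull-port cell, observer-set / OES technique; `--supports stmt-CriticalPhenomena-4575`).
No definitions, no named facts, no sorries.  Setting and notation of `…CILAveragedPortForward` (prover `prim-lf-3`): `o ∉ A`
relay-neighboured with ports `p 0..p (d−1)` (injective) in FORWARD-GREEDY order, `F_l` = "`p l` is the first open port",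
`Z = {no pair o–p l is open}`, `I_w(v) = μ_w{|π(v)| ≤ j}`.

* `AveragedPort.bad_le_firstOpenSum_forward_plus` — **AP1⁺:** for every vertex `x` that is dominated by `p l` in the cut graph `w^{[l]}`
  for every `l` (e.g. any vertex no lighter than every port of `o` in every cut graph),
  `μ{1 ≤ N ≤ j} + μ(Z ∩ {x light}) ≤ Σ_l μ(F_l)·I_w(p l) + μ(Z)·I_w(x)`,
  i.e. prim-lf-3's averaged port domination has slack at least `μ(Z)·(I_{w∖o}(x) − I_w(x))` = "P(no open coin) × the
  observer's influence on `x`".  Proof = lf-3's first-port induction verbatim with one more glue-cost term: the stage inequality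
  becomes `Σ_l μ₀(F′_l)·δ(p′ l) + μ₀(Z′)·δ(x) ≤ Δ` (`δ` = cost of gluing `p 0` onto `o`, `Δ` its own cost), which is
  `ExchangeTools.glueCost_le` termwise together with `Σ_l μ₀(F′_l) + μ₀(Z′) = 1`.
  (Crux evidence HP6-MEMO3-SETAP1.md §5–6: AP1⁺ holds numerically for EVERY vertex `x` — 0 violations in ≈ 2.5·10⁴ exact instances —
  and on paper for every relay `x` in the `(G−o)`-champion order via lf-3's light-side exchange; the domination hypothesis here is what
  the termwise glue-cost route needs.)  USE: AP1⁺ is the single-observer input `hAP1plus` of `SetPort.hsap_pair` /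
  `SetPort.bad_pair_le_hier` (hierarchical set averaged-port inequality ⟹ lf-3's c-free core (APz) for a glued pair).
-/

noncomputable section

namespace Summit.CriticalPhenomena.PercolationContinuityZ3.Theorems

open MeasureTheory Set Literature.Probability.LatticeModels Literature.Probability.Percolation
open scoped Classical BigOperators

variable {n : ℕ}

namespace AveragedPort

/-- **AP1⁺ (averaged port domination with the isolation slack), forward-greedy order.**  `o ∉ A` relay-neighboured with ports
`p 0..p (d−1)` (injective) such that for all `l < m` the port `p l` is at least as light as `p m` once the pairs `o–p i`, `i ≤ l`,
are deleted, and a vertex `x` at most as light as `p l` in the same cut graph, for every `l`.  Then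
`μ{1 ≤ N ≤ j} + μ({no open pair at o} ∩ {x light}) ≤ Σ_l μ(F_l)·μ{|π(p l)| ≤ j} + μ{no open pair at o}·μ{|π(x)| ≤ j}`.
[this file; derived from prim-lf-3's `bad_le_firstOpenSum_forward` proof and `ExchangeTools.glueCost_le`
(VandenbergHaggstromKahn2005 Thm. 1.5 is the only probabilistic input)] -/
theorem bad_le_firstOpenSum_forward_plus :
    ∀ (d : ℕ) (w : Sym2 (Fin n) → unitInterval) (A : Finset (Fin n)) (o : Fin n) (j : ℕ) (p : Fin d → Fin n) (x : Fin n),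
      Function.Injective p → (∀ l, p l ∈ A) → o ∉ A →
      (∀ v, w s(o, v) ≠ 0 → ∃ l, v = p l) →
      (∀ l m : Fin d, l < m →
        (prodBernoulli (fun e => if (∃ i : Fin d, i ≤ l ∧ e = s(o, p i)) then (0 : unitInterval) else w e)).real
            {ω : BondConfig (Fin n) | (A.filter fun z => ω ∈ openConn (p m) z).card ≤ j} ≤
          (prodBernoulli (fun e => if (∃ i : Fin d, i ≤ l ∧ e = s(o, p i)) then (0 : unitInterval) else w e)).real
            {ω : BondConfig (Fin n) | (A.filter fun z => ω ∈ openConn (p l) z).card ≤ j}) →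
      (∀ l : Fin d,
        (prodBernoulli (fun e => if (∃ i : Fin d, i ≤ l ∧ e = s(o, p i)) then (0 : unitInterval) else w e)).real
            {ω : BondConfig (Fin n) | (A.filter fun z => ω ∈ openConn x z).card ≤ j} ≤
          (prodBernoulli (fun e => if (∃ i : Fin d, i ≤ l ∧ e = s(o, p i)) then (0 : unitInterval) else w e)).real
            {ω : BondConfig (Fin n) | (A.filter fun z => ω ∈ openConn (p l) z).card ≤ j}) →
      (prodBernoulli w).real {ω : BondConfig (Fin n) |
          1 ≤ (A.filter fun z => ω ∈ openConn o z).card ∧ (A.filter fun z => ω ∈ openConn o z).card ≤ j} +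
        (prodBernoulli w).real ({ω : BondConfig (Fin n) | ∀ l : Fin d, s(o, p l) ∉ ω} ∩
          {ω : BondConfig (Fin n) | (A.filter fun z => ω ∈ openConn x z).card ≤ j}) ≤
        ∑ l : Fin d, (prodBernoulli w).real {ω : BondConfig (Fin n) | s(o, p l) ∈ ω ∧ ∀ m, m < l → s(o, p m) ∉ ω} *
          (prodBernoulli w).real {ω : BondConfig (Fin n) | (A.filter fun z => ω ∈ openConn (p l) z).card ≤ j} +
        (prodBernoulli w).real {ω : BondConfig (Fin n) | ∀ l : Fin d, s(o, p l) ∉ ω} *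
          (prodBernoulli w).real {ω : BondConfig (Fin n) | (A.filter fun z => ω ∈ openConn x z).card ≤ j} := by
  intro d
  induction d with
  | zero =>
    intro w A o j p x hp hpA hoA hobs hFG hx
    rw [Finset.univ_eq_empty, Finset.sum_empty]
    -- `o` is almost surely isolated: the bad event does not meet the support event
    set bad := {ω : BondConfig (Fin n) |
      1 ≤ (A.filter fun z => ω ∈ openConn o z).card ∧ (A.filter fun z => ω ∈ openConn o z).card ≤ j} with hbad
    have hempty : bad ∩ {ω : BondConfig (Fin n) | ∀ e ∈ ω, w e ≠ 0} = ∅ := by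
      refine Set.eq_empty_iff_forall_notMem.2 ?_
      rintro ω ⟨⟨h1, -⟩, hωG⟩
      obtain ⟨z, hz⟩ := Finset.card_pos.1 (by omega : 0 < (A.filter fun z => ω ∈ openConn o z).card)
      rw [Finset.mem_filter] at hz
      have hzo : z ≠ o := fun h => hoA (h ▸ hz.1)
      obtain ⟨wk⟩ := (hz.2 : (openGraph ω).Reachable o z)
      cases wk with
      | nil => exact absurd rfl hzo
      | @cons _ v _ hadj _ =>
        rw [openGraph, SimpleGraph.fromEdgeSet_adj] at hadj
        obtain ⟨l, -⟩ := hobs v (hωG _ hadj.1)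
        exact l.elim0
    have := CutObserver.measureReal_inter_support w bad
    rw [hempty, measureReal_empty] at this
    rw [← this]
    have hZ : {ω : BondConfig (Fin n) | ∀ l : Fin 0, s(o, p l) ∉ ω} = Set.univ := by
      ext ω; simp only [mem_setOf_eq, mem_univ, iff_true]; intro l; exact l.elim0
    haveI : IsProbabilityMeasure (prodBernoulli w) := inferInstance
    rw [hZ, Set.univ_inter, probReal_univ]
    linarith
  | succ d ih =>
    intro w A o j p x hp hpA hoA hobs hFG hx
    -- the first port `a = p 0`, its pair `e`, the two endpoint weight functions, the later ports `p'`
    set a : Fin n := p 0 with ha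
    set e : Sym2 (Fin n) := s(o, a) with he
    set w₀ := Function.update w e 0 with hw₀
    set w₁ := Function.update w e 1 with hw₁
    set p' : Fin d → Fin n := fun i => p i.succ with hp'
    have haA : a ∈ A := hpA _
    have hoa : o ≠ a := fun h => hoA (h ▸ haA)
    have hp'inj : Function.Injective p' := fun i i' h => Fin.succ_injective _ (hp h)
    have hp'a : ∀ i : Fin d, p' i ≠ a := fun i h => absurd (hp h) (Fin.succ_ne_zero i)
    have hne_e : ∀ i : Fin d, s(o, p' i) ≠ e := fun i h => hp'a i (Sym2.congr_right.1 h)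
    have hw0e : w₀ s(o, a) = 0 := by rw [← he, hw₀, Function.update_self]
    have hw0e' : w₀ s(a, o) = 0 := by rw [Sym2.eq_swap]; exact hw0e
    have hw1' : w₁ = Function.update w₀ s(o, a) 1 := by rw [hw₁, hw₀, ← he, Function.update_idem]
    have hw0_agree : ∀ i : Fin d, w₀ s(o, p' i) = w s(o, p' i) := fun i => by rw [hw₀, Function.update_of_ne (hne_e i)]
    -- lightness sets and the bad event
    set L : Fin n → Set (BondConfig (Fin n)) := fun x => {ω | (A.filter fun z => ω ∈ openConn x z).card ≤ j} with hL
    set bad : Set (BondConfig (Fin n)) := {ω |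
      1 ≤ (A.filter fun z => ω ∈ openConn o z).card ∧ (A.filter fun z => ω ∈ openConn o z).card ≤ j} with hbad
    -- (1) the cut weight function at index `0` is `w₀`
    have hcut0 : (fun e' => if (∃ i : Fin (d+1), i ≤ 0 ∧ e' = s(o, p i)) then (0 : unitInterval) else w e') = w₀ := by
      funext e'
      rw [hw₀, Function.update_apply]
      by_cases hee : e' = e
      · have hC : ∃ i : Fin (d+1), i ≤ 0 ∧ e' = s(o, p i) := ⟨0, le_rfl, by rw [hee, he, ha]⟩
        rw [if_pos hC, if_pos hee]
      · have hC : ¬ ∃ i : Fin (d+1), i ≤ 0 ∧ e' = s(o, p i) := by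
          rintro ⟨i, hi, he'⟩
          have hi0 : i = 0 := Fin.le_zero_iff.1 hi
          exact hee (by rw [he', hi0, he, ha])
        rw [if_neg hC, if_neg hee]
    -- domination of every later port by `a` in `w₀` (forward-greedy hypothesis at index `0`)
    have hdom : ∀ m : Fin d, (prodBernoulli w₀).real (L (p' m)) ≤ (prodBernoulli w₀).real (L a) := by
      intro m
      have h := hFG 0 m.succ (Fin.succ_pos m)
      rw [hcut0] at h
      exact h
    -- (2) the forward-greedy hypothesis for the later ports in `w₀`
    have hcut : ∀ l' : Fin d,
        (fun e' => if (∃ i : Fin d, i ≤ l' ∧ e' = s(o, p' i)) then (0 : unitInterval) else w₀ e') =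
        (fun e' => if (∃ i : Fin (d+1), i ≤ l'.succ ∧ e' = s(o, p i)) then (0 : unitInterval) else w e') := by
      intro l'
      funext e'
      by_cases hC0 : ∃ i : Fin d, i ≤ l' ∧ e' = s(o, p' i)
      · have hC1 : ∃ i : Fin (d+1), i ≤ l'.succ ∧ e' = s(o, p i) := by
          obtain ⟨i, hi, he'⟩ := hC0
          exact ⟨i.succ, Fin.succ_le_succ_iff.2 hi, he'⟩
        rw [if_pos hC0, if_pos hC1]
      · rw [if_neg hC0, hw₀, Function.update_apply]
        by_cases hee : e' = e
        · have hC1 : ∃ i : Fin (d+1), i ≤ l'.succ ∧ e' = s(o, p i) :=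
            ⟨0, Fin.zero_le _, by rw [hee, he, ha]⟩
          rw [if_pos hee, if_pos hC1]
        · have hC1 : ¬ ∃ i : Fin (d+1), i ≤ l'.succ ∧ e' = s(o, p i) := by
            rintro ⟨i, hi, he'⟩
            rcases Fin.eq_zero_or_eq_succ i with rfl | ⟨i', rfl⟩
            · exact hee (by rw [he', he, ha])
            · exact hC0 ⟨i', Fin.succ_le_succ_iff.1 hi, he'⟩
          rw [if_neg hee, if_neg hC1]
    have hFG0 : ∀ l' m' : Fin d, l' < m' →
        (prodBernoulli (fun e' => if (∃ i : Fin d, i ≤ l' ∧ e' = s(o, p' i)) then (0 : unitInterval) else w₀ e')).real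
            (L (p' m')) ≤
          (prodBernoulli (fun e' => if (∃ i : Fin d, i ≤ l' ∧ e' = s(o, p' i)) then (0 : unitInterval) else w₀ e')).real
            (L (p' l')) := by
      intro l' m' hlm
      rw [hcut l']
      exact hFG l'.succ m'.succ (Fin.succ_lt_succ_iff.2 hlm)
    have hobs0 : ∀ v, w₀ s(o, v) ≠ 0 → ∃ l' : Fin d, v = p' l' := by
      intro v hv
      have hve : s(o, v) ≠ e := fun h => hv (by rw [h, hw₀, Function.update_self])
      have hv' : w s(o, v) ≠ 0 := by rwa [hw₀, Function.update_of_ne hve] at hv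
      obtain ⟨l, rfl⟩ := hobs v hv'
      rcases Fin.eq_zero_or_eq_succ l with rfl | ⟨l', rfl⟩
      · exact absurd (by rw [he, ha]) hve
      · exact ⟨l', rfl⟩
    have hx0 : ∀ l' : Fin d,
        (prodBernoulli (fun e' => if (∃ i : Fin d, i ≤ l' ∧ e' = s(o, p' i)) then (0 : unitInterval) else w₀ e')).real
            (L x) ≤
          (prodBernoulli (fun e' => if (∃ i : Fin d, i ≤ l' ∧ e' = s(o, p' i)) then (0 : unitInterval) else w₀ e')).real
            (L (p' l')) := by
      intro l'
      rw [hcut l']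
      exact hx l'.succ
    have hdomx : (prodBernoulli w₀).real (L x) ≤ (prodBernoulli w₀).real (L a) := by
      have h := hx 0
      rw [hcut0] at h
      exact h
    -- (3) induction hypothesis at weight 0
    have hIH := ih w₀ A o j p' x hp'inj (fun l => hpA _) hoA hobs0 hFG0 hx0
    -- (4) the first-open events
    set F : Fin (d+1) → Set (BondConfig (Fin n)) := fun l => {ω | s(o, p l) ∈ ω ∧ ∀ m, m < l → s(o, p m) ∉ ω} with hF
    set F' : Fin d → Set (BondConfig (Fin n)) := fun l' => {ω | s(o, p' l') ∈ ω ∧ ∀ m', m' < l' → s(o, p' m') ∉ ω} with hF'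
    have hF0 : F 0 = {ω | e ∈ ω} := by
      ext ω
      simp only [hF, mem_setOf_eq]
      constructor
      · intro h; rw [he, ha]; exact h.1
      · intro h
        refine ⟨by rw [he, ha] at h; exact h, fun m hm => absurd hm (not_lt.2 (Fin.zero_le m))⟩
    have hFsucc : ∀ l' : Fin d, F l'.succ = F' l' ∩ {ω | e ∉ ω} := by
      intro l'
      ext ω
      simp only [hF, hF', mem_setOf_eq, mem_inter_iff]
      constructor
      · rintro ⟨h1, h2⟩
        refine ⟨⟨h1, fun m' hm' => h2 m'.succ (Fin.succ_lt_succ_iff.2 hm')⟩, ?_⟩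
        rw [he, ha]; exact h2 0 (Fin.succ_pos _)
      · rintro ⟨⟨h1, h2⟩, h0⟩
        refine ⟨h1, fun m hm => ?_⟩
        rcases Fin.eq_zero_or_eq_succ m with rfl | ⟨m', rfl⟩
        · rw [he, ha] at h0; exact h0
        · exact h2 m' (Fin.succ_lt_succ_iff.1 hm)
    -- (5) the measures involved
    set t : ℝ := (w e : ℝ) with ht
    have ht0 : 0 ≤ t := (w e).2.1
    have ht1 : t ≤ 1 := (w e).2.2
    haveI : IsProbabilityMeasure (prodBernoulli w) := inferInstance
    haveI : IsProbabilityMeasure (prodBernoulli w₀) := inferInstance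
    have hPF0 : (prodBernoulli w).real (F 0) = t := by
      have h := real_firstOpen_eq_mul w o p hp 0
      have huniv : {ω : BondConfig (Fin n) | ∀ m : Fin (d+1), m < 0 → s(o, p m) ∉ ω} = Set.univ := by
        ext ω
        simp only [mem_setOf_eq, mem_univ, iff_true]
        intro m hm
        exact absurd hm (not_lt.2 (Fin.zero_le m))
      rw [huniv, probReal_univ, mul_one] at h
      rw [show F 0 = {ω | s(o, p 0) ∈ ω ∧ ∀ m, m < 0 → s(o, p m) ∉ ω} from rfl, h, ht, he, ha]
    have hPF1 : ∀ l' : Fin d, (prodBernoulli w₁).real (F l'.succ) = 0 := by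
      intro l'
      rw [hw1', ChampionStability.real_update_one_eq w₀ hw0e]
      have hemp : (fun ω : BondConfig (Fin n) => insert s(o, a) ω) ⁻¹' (F l'.succ) = ∅ := by
        refine Set.eq_empty_iff_forall_notMem.2 fun ω hω => ?_
        rw [mem_preimage, hFsucc l'] at hω
        exact hω.2 (by rw [he]; exact Set.mem_insert _ _)
      rw [hemp, measureReal_empty]
    have hPF0' : ∀ l' : Fin d, (prodBernoulli w₀).real (F l'.succ) = (prodBernoulli w₀).real (F' l') := by
      intro l'
      rw [← CutObserver.measureReal_inter_support w₀ (F l'.succ), ← CutObserver.measureReal_inter_support w₀ (F' l')]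
      congr 1
      ext ω
      rw [hFsucc l']
      simp only [mem_inter_iff, mem_setOf_eq]
      constructor
      · rintro ⟨⟨h1, -⟩, h3⟩; exact ⟨h1, h3⟩
      · rintro ⟨h1, h3⟩
        refine ⟨⟨h1, fun hmem => ?_⟩, h3⟩
        exact h3 e hmem (by rw [he]; exact hw0e)
    have hPFsucc : ∀ l' : Fin d, (prodBernoulli w).real (F l'.succ) = (1 - t) * (prodBernoulli w₀).real (F' l') := by
      intro l'
      rw [stub_oneBondDecomp_k15 n w e (F l'.succ), ← hw₀, ← hw₁, hPF1 l', hPF0' l', ← ht, mul_zero, add_zero]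
    have hbad_dec := stub_oneBondDecomp_k15 n w e bad
    have hI_dec : ∀ x : Fin n, (prodBernoulli w).real (L x) =
        (1 - t) * (prodBernoulli w₀).real (L x) + t * (prodBernoulli w₁).real (L x) := fun x => by
      rw [stub_oneBondDecomp_k15 n w e (L x)]
    have hbad1 : (prodBernoulli w₁).real bad = (prodBernoulli w₁).real (L a) := by
      rw [hw1']; exact real_bad_update_one_eq w₀ A o a j hoa haA hw0e
    -- the all-closed events `Z ⊇`: `Z = Z' ∩ {e ∉ ω}`
    set Z : Set (BondConfig (Fin n)) := {ω | ∀ l : Fin (d+1), s(o, p l) ∉ ω} with hZ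
    set Z' : Set (BondConfig (Fin n)) := {ω | ∀ l' : Fin d, s(o, p' l') ∉ ω} with hZ'
    have hZsucc : Z = Z' ∩ {ω | e ∉ ω} := by
      ext ω
      simp only [hZ, hZ', mem_setOf_eq, mem_inter_iff]
      constructor
      · intro h
        refine ⟨fun l' => h l'.succ, ?_⟩
        rw [he, ha]; exact h 0
      · rintro ⟨h, h0⟩ l
        rcases Fin.eq_zero_or_eq_succ l with rfl | ⟨l', rfl⟩
        · rw [he, ha] at h0; exact h0
        · exact h l'
    have hZ1 : ∀ S : Set (BondConfig (Fin n)), (prodBernoulli w₁).real (Z ∩ S) = 0 := by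
      intro S
      rw [hw1', ChampionStability.real_update_one_eq w₀ hw0e]
      have hemp : (fun ω : BondConfig (Fin n) => insert s(o, a) ω) ⁻¹' (Z ∩ S) = ∅ := by
        refine Set.eq_empty_iff_forall_notMem.2 fun ω hω => ?_
        rw [mem_preimage, hZsucc] at hω
        exact hω.1.2 (by rw [he]; exact Set.mem_insert _ _)
      rw [hemp, measureReal_empty]
    have hZ0 : ∀ S : Set (BondConfig (Fin n)), (prodBernoulli w₀).real (Z ∩ S) = (prodBernoulli w₀).real (Z' ∩ S) := by
      intro S
      rw [← CutObserver.measureReal_inter_support w₀ (Z ∩ S), ← CutObserver.measureReal_inter_support w₀ (Z' ∩ S)]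
      congr 1
      ext ω
      rw [hZsucc]
      simp only [mem_inter_iff, mem_setOf_eq]
      constructor
      · rintro ⟨⟨⟨h1, -⟩, h2⟩, h3⟩; exact ⟨⟨h1, h2⟩, h3⟩
      · rintro ⟨⟨h1, h2⟩, h3⟩
        refine ⟨⟨⟨h1, fun hmem => ?_⟩, h2⟩, h3⟩
        exact h3 e hmem (by rw [he]; exact hw0e)
    have hZdec : (prodBernoulli w).real Z = (1 - t) * (prodBernoulli w₀).real Z' := by
      have h := stub_oneBondDecomp_k15 n w e Z
      rw [← hw₀, ← hw₁, ← ht] at h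
      have h1 := hZ1 Set.univ
      have h0 := hZ0 Set.univ
      rw [Set.inter_univ] at h1 h0
      rw [Set.inter_univ] at h0
      rw [h, h1, h0, mul_zero, add_zero]
    have hZLdec : (prodBernoulli w).real (Z ∩ L x) = (1 - t) * (prodBernoulli w₀).real (Z' ∩ L x) := by
      have h := stub_oneBondDecomp_k15 n w e (Z ∩ L x)
      rw [← hw₀, ← hw₁, ← ht] at h
      rw [h, hZ1 (L x), hZ0 (L x), mul_zero, add_zero]
    have hsum1 : ∑ l' : Fin d, (prodBernoulli w₀).real (F' l') + (prodBernoulli w₀).real Z' = 1 :=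
      sum_real_firstOpen_add_allClosed w₀ o p'
    -- (6) the stage inequality: glue-cost domination termwise
    have hglue : ∀ l' : Fin d, (prodBernoulli w₀).real (L (p' l')) - (prodBernoulli w₁).real (L (p' l')) ≤
        (prodBernoulli w₀).real (L a) - (prodBernoulli w₁).real (L a) := by
      intro l'
      have h := ExchangeTools.glueCost_le w₀ A a o (p' l') j hoa.symm hw0e' (hdom l')
      rw [Sym2.eq_swap, ← hw1'] at h
      exact h
    have hglue_x : (prodBernoulli w₀).real (L x) - (prodBernoulli w₁).real (L x) ≤
        (prodBernoulli w₀).real (L a) - (prodBernoulli w₁).real (L a) := by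
      have h := ExchangeTools.glueCost_le w₀ A a o x j hoa.symm hw0e' hdomx
      rw [Sym2.eq_swap, ← hw1'] at h
      exact h
    have hanti : (prodBernoulli w₁).real (L a) ≤ (prodBernoulli w₀).real (L a) := lightness_one_le_zero w A e a j
    have hsumF' : ∑ l' : Fin d, (prodBernoulli w₀).real (F' l') ≤ 1 := by
      have h := sum_real_firstOpen_add_allClosed w₀ o p'
      have hZ : 0 ≤ (prodBernoulli w₀).real {ω : BondConfig (Fin n) | ∀ m' : Fin d, s(o, p' m') ∉ ω} := measureReal_nonneg
      have h' : ∑ l' : Fin d, (prodBernoulli w₀).real {ω : BondConfig (Fin n) | s(o, p' l') ∈ ω ∧ ∀ m', m' < l' → s(o, p' m') ∉ ω}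
          = ∑ l' : Fin d, (prodBernoulli w₀).real (F' l') := rfl
      linarith
    set S0 : ℝ := ∑ l' : Fin d, (prodBernoulli w₀).real (F' l') * (prodBernoulli w₀).real (L (p' l')) with hS0
    set S1 : ℝ := ∑ l' : Fin d, (prodBernoulli w₀).real (F' l') * (prodBernoulli w₁).real (L (p' l')) with hS1
    have hstage : S0 - S1 + (prodBernoulli w₀).real Z' * ((prodBernoulli w₀).real (L x) - (prodBernoulli w₁).real (L x)) ≤
        (prodBernoulli w₀).real (L a) - (prodBernoulli w₁).real (L a) := by
      have hdiff : S0 - S1 = ∑ l' : Fin d, (prodBernoulli w₀).real (F' l') *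
          ((prodBernoulli w₀).real (L (p' l')) - (prodBernoulli w₁).real (L (p' l'))) := by
        rw [hS0, hS1, ← Finset.sum_sub_distrib]
        exact Finset.sum_congr rfl fun l' _ => by ring
      rw [hdiff]
      have hZ'0 : 0 ≤ (prodBernoulli w₀).real Z' := measureReal_nonneg
      calc ∑ l' : Fin d, (prodBernoulli w₀).real (F' l') *
            ((prodBernoulli w₀).real (L (p' l')) - (prodBernoulli w₁).real (L (p' l'))) +
            (prodBernoulli w₀).real Z' * ((prodBernoulli w₀).real (L x) - (prodBernoulli w₁).real (L x))
          ≤ ∑ l' : Fin d, (prodBernoulli w₀).real (F' l') *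
              ((prodBernoulli w₀).real (L a) - (prodBernoulli w₁).real (L a)) +
            (prodBernoulli w₀).real Z' * ((prodBernoulli w₀).real (L a) - (prodBernoulli w₁).real (L a)) :=
            add_le_add (Finset.sum_le_sum fun l' _ => mul_le_mul_of_nonneg_left (hglue l') measureReal_nonneg)
              (mul_le_mul_of_nonneg_left hglue_x hZ'0)
        _ = (∑ l' : Fin d, (prodBernoulli w₀).real (F' l') + (prodBernoulli w₀).real Z') *
              ((prodBernoulli w₀).real (L a) - (prodBernoulli w₁).real (L a)) := by rw [add_mul, Finset.sum_mul]
        _ = (prodBernoulli w₀).real (L a) - (prodBernoulli w₁).real (L a) := by rw [hsum1, one_mul]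
    -- (7) assembly
    have hIH' : (prodBernoulli w₀).real bad + (prodBernoulli w₀).real (Z' ∩ L x) ≤
        S0 + (prodBernoulli w₀).real Z' * (prodBernoulli w₀).real (L x) := hIH
    have hsum_eq : ∑ l' : Fin d, (prodBernoulli w).real (F l'.succ) * (prodBernoulli w).real (L (p l'.succ)) =
        (1 - t) * (1 - t) * S0 + (1 - t) * t * S1 := by
      have h1 : ∑ l' : Fin d, (prodBernoulli w).real (F l'.succ) * (prodBernoulli w).real (L (p l'.succ)) =
          ∑ l' : Fin d, ((1 - t) * (1 - t) * ((prodBernoulli w₀).real (F' l') * (prodBernoulli w₀).real (L (p' l'))) +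
            (1 - t) * t * ((prodBernoulli w₀).real (F' l') * (prodBernoulli w₁).real (L (p' l')))) := by
        refine Finset.sum_congr rfl fun l' _ => ?_
        rw [hPFsucc l', show p l'.succ = p' l' from rfl, hI_dec (p' l')]
        ring
      rw [h1, Finset.sum_add_distrib, ← Finset.mul_sum, ← Finset.mul_sum]
    rw [Fin.sum_univ_succ]
    show (prodBernoulli w).real bad + (prodBernoulli w).real (Z ∩ L x) ≤
        (prodBernoulli w).real (F 0) * (prodBernoulli w).real (L (p 0)) +
          ∑ l' : Fin d, (prodBernoulli w).real (F l'.succ) * (prodBernoulli w).real (L (p l'.succ)) +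
        (prodBernoulli w).real Z * (prodBernoulli w).real (L x)
    rw [hsum_eq, hPF0, hbad_dec, hZLdec, hZdec, ← hw₀, ← hw₁, ← ht, hbad1, show p 0 = a from rfl, hI_dec a, hI_dec x]
    have hA : 0 ≤ (1 - t) * (S0 + (prodBernoulli w₀).real Z' * (prodBernoulli w₀).real (L x) -
        (prodBernoulli w₀).real bad - (prodBernoulli w₀).real (Z' ∩ L x)) := mul_nonneg (by linarith) (by linarith)
    have hB : 0 ≤ t * (1 - t) * (((prodBernoulli w₀).real (L a) - (prodBernoulli w₁).real (L a)) - (S0 - S1) -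
        (prodBernoulli w₀).real Z' * ((prodBernoulli w₀).real (L x) - (prodBernoulli w₁).real (L x))) :=
      mul_nonneg (mul_nonneg ht0 (by linarith)) (by linarith)
    nlinarith [hA, hB]


end AveragedPort

end Summit.CriticalPhenomena.PercolationContinuityZ3.Theorems

end
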